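import Summits.PneNP.PneNP.Theorems.ChebyshevTracialDesignTiltedJuntaTools
import Summits.PneNP.PneNP.Theorems.ChebyshevTracialDesignTiltedSmallBlockExpansion
import HarnessLib

/-!
# Cell pnp-psdrank, route `ChebyshevTracialDesign`: TILTED JUNTAS ON A SMALL BLOCK — the seven-term expansion (brick J2 = 162b; crux
# `TracialDecayExp20`, stmt-PneNP-19878)

Brick 162b (prover g31; MEMO-34 §6). With `A(I) = Σ_{v∈I} α_v`, `Y_v = [v ∈ half U]` and `Λ = A(U∩H) + L − κc`, pointwise
`f(U∩H)(Λ − Σ_vα_vY_v)² = fΛ² − 2Σ_v α_v·(fΛ)·Y_v + Σ_v α_v²f·Y_v + Σ_vΣ_{w∉e_v} α_vα_w f·Y_vY_w`, and after the half-pinning identities of brick 162a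
the shell average at level `c` is a sum of SEVEN pieces of brick 151b's shape (`avg_tilted_expand_J`; `levelSum_tilted_expand_J` regroups the
weighted level sum with 151b `sum_regroup7`): main piece `E[fΛ²]` on `S`, the pinned pieces on `S∖e_v` and `S∖e_v∖e_w` with the pinned junta masks.
§5 tools for the assembly: `junta_amplitude_abs_le` (`|A(I) + L| ≤ 4b + L₀` when `|α| ≤ 4`, `|I| ≤ b`), `junta_mask_bounds` (the pinned masks are
again juntas in `[0, G]`), `seven_piece_bound` (brick 151's assembly polynomial with the junta constants).
WHAT THIS FILE DOES NOT DO: the assembly `tiltedJunta_levelSum_le` (162c). [cite: Rothvoss2017, §2 (PDF p. 6)] [cite: RollinRoss2010, §3 (Lemma 3.1)]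
Stature: support/instrument (kernel lane, no defs, axioms standard). WHAT THIS IS NOT: nothing on spread / non-junta masks (the open heart, N2), no proof or refutation of
`TracialDecayExp20`, nothing on psd rank of P_PM(K_n), no P-vs-NP content. Supports stmt-PneNP-19878.
-/

set_option linter.dupNamespace false -- `Summit.PneNP.PneNP.…`: summit = sub-problem (D-0017)

noncomputable section

namespace Summit.PneNP.PneNP.Theorems.ChebyshevTracialDesignTiltedJuntaExpansion

open Finset Polynomial Literature.Barriers.PneNP Literature.Combinatorics.Optimization
open Literature.Combinatorics.Optimization.ShellStep
open Summit.PneNP.PneNP.Theorems.ChebyshevTracialDesignTiltedJuntaTools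
open Summit.PneNP.PneNP.Theorems.ChebyshevTracialDesignTiltedSmallBlockExpansion (sum_regroup7)

variable {n : ℕ}

/-! ### §3 The seven-term expansion of the tilted junta shell average -/

section Expand

variable {π : Fin n → Fin n} (hπ : ∀ v, π (π v) = v) (hπ' : ∀ v, π v ≠ v)
include hπ hπ'

/-- **The tilted junta shell average, expanded and half-pinned** (every level `c'`; the shell nonempty when `c' ≥ 1`; `t' ≥ 2`).
With `A(I) = Σ_{v∈I} α_v`, `Φ₁(I) = f(I)(A(I)+L)`, `Φ₀(I) = f(I)(A(I)+L)²`, `Y_v = [v ∈ half U]`: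
`E_{Shell_S(t',c')}[f(U∩H)(A(U∩H) − Σ_v α_vY_v + L − κ·c)²] = E[Φ₀] − 2κc·E[Φ₁] + κ²c²·E[f] − 2(c'/|S|)Σ_v α_v E_v[Φ₁(·+v)]`
`+ 2κc(c'/|S|)Σ_v α_v E_v[f(·+v)] + (c'/|S|)Σ_v α_v² E_v[f(·+v)] + (c'(c'−1)/(|S|(|S|−2)))Σ_vΣ_w α_vα_w E_{vw}[f(·+v+w)]`.
[cite: Rothvoss2017, §2 (PDF p. 6)] -/
theorem avg_tilted_expand_J {S : Finset (Fin n)} (hS : ∀ u ∈ S, π u ∈ S) (H : Finset (Fin n)) {t' : ℕ} (ht' : 2 ≤ t')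
    (c' : ℕ) (hne : 1 ≤ c' → (shellIn π S t' c').Nonempty) (f : Finset (Fin n) → ℝ) (α : Fin n → ℝ) (kap L cR : ℝ) :
    (∑ U ∈ shellIn π S t' c', f (U ∩ H) *
        ((∑ v ∈ U ∩ H, α v) - (∑ v ∈ S ∩ H, α v * (if (v ∈ U ∧ π v ∉ U) then (1 : ℝ) else 0)) + L - kap * cR) ^ 2) /
        ((shellIn π S t' c').card : ℝ) =
      (∑ U ∈ shellIn π S t' c', (fun I => f I * ((∑ v ∈ I, α v) + L) ^ 2) (U ∩ H)) / ((shellIn π S t' c').card : ℝ)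
      - 2 * kap * cR * ((∑ U ∈ shellIn π S t' c', (fun I => f I * ((∑ v ∈ I, α v) + L)) (U ∩ H)) /
          ((shellIn π S t' c').card : ℝ))
      + kap ^ 2 * cR ^ 2 * ((∑ U ∈ shellIn π S t' c', f (U ∩ H)) / ((shellIn π S t' c').card : ℝ))
      - 2 * (((c' : ℝ) / (S.card : ℝ)) * ∑ v ∈ S ∩ H, α v *
          ((∑ W ∈ shellIn π (S \ {v, π v}) (t' - 1) (c' - 1),
              (fun J => f (insert v J) * ((∑ u ∈ insert v J, α u) + L)) (W ∩ H)) /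
            ((shellIn π (S \ {v, π v}) (t' - 1) (c' - 1)).card : ℝ)))
      + 2 * kap * cR * (((c' : ℝ) / (S.card : ℝ)) * ∑ v ∈ S ∩ H, α v *
          ((∑ W ∈ shellIn π (S \ {v, π v}) (t' - 1) (c' - 1), (fun J => f (insert v J)) (W ∩ H)) /
            ((shellIn π (S \ {v, π v}) (t' - 1) (c' - 1)).card : ℝ)))
      + (((c' : ℝ) / (S.card : ℝ)) * ∑ v ∈ S ∩ H, α v ^ 2 *
          ((∑ W ∈ shellIn π (S \ {v, π v}) (t' - 1) (c' - 1), (fun J => f (insert v J)) (W ∩ H)) /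
            ((shellIn π (S \ {v, π v}) (t' - 1) (c' - 1)).card : ℝ)))
      + ((((c' : ℝ) * ((c' : ℝ) - 1)) / ((S.card : ℝ) * ((S.card : ℝ) - 2))) *
          ∑ v ∈ S ∩ H, ∑ w ∈ (S ∩ H) \ {v, π v}, α v * α w *
            ((∑ W ∈ shellIn π (del2 π S v w) (t' - 2) (c' - 2), (fun J => f (insert v (insert w J))) (W ∩ H)) /
              ((shellIn π (del2 π S v w) (t' - 2) (c' - 2)).card : ℝ))) := by
  have h1 := avg_wHalf_junta_eq hπ hπ' hS H (by omega : 1 ≤ t') c' α (fun I => f I * ((∑ v ∈ I, α v) + L)) hne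
  have h2 := avg_wHalf_junta_eq hπ hπ' hS H (by omega : 1 ≤ t') c' α f hne
  have h3 := avg_wHalf_junta_eq hπ hπ' hS H (by omega : 1 ≤ t') c' (fun v => α v ^ 2) f hne
  have h4 := avg_wHalfPairs_junta_eq hπ hπ' hS H ht' c' α f (fun h => hne (by omega))
  simp only [] at h1 h2 h3 h4 ⊢
  rw [← h1, ← h2, ← h3, ← h4]
  set K : ℝ := ((shellIn π S t' c').card : ℝ)
  simp only [div_eq_mul_inv]
  rw [show ∀ a b c d e e' g : ℝ, a * K⁻¹ - 2 * kap * cR * (b * K⁻¹) + kap ^ 2 * cR ^ 2 * (c * K⁻¹) - 2 * (d * K⁻¹)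
      + 2 * kap * cR * (e * K⁻¹) + e' * K⁻¹ + g * K⁻¹ =
      (a - 2 * kap * cR * b + kap ^ 2 * cR ^ 2 * c - 2 * d + 2 * kap * cR * e + e' + g) * K⁻¹ from
      fun a b c d e e' g => by ring]
  congr 1
  simp only [mul_sum, ← sum_add_distrib, ← sum_sub_distrib]
  refine sum_congr rfl fun U _ => ?_
  have hsq := wHalf_sq_eq (π := π) S H U α
  linear_combination (f (U ∩ H)) * hsq

end Expand

/-! ### §4 The weighted level sum, expanded -/

section LevelSum

variable {π : Fin n → Fin n} (hπ : ∀ v, π (π v) = v) (hπ' : ∀ v, π v ≠ v)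
include hπ hπ'

/-- **The weighted level sum of the tilted junta profile, expanded into seven polynomially weighted pieces** (any rule `(C, w)`, a
weight `p` vanishing on the levels `c < g`, nonempty shells at the levels `c ≥ g+1`): weights `p`, `pX`, `pX²`, `p(X−g)`, `pX(X−g)`,
`p(X−g)`, `p(X−g)(X−g−1)` (brick 151b's). [cite: Rothvoss2017, §2 (PDF p. 6)] -/
theorem levelSum_tilted_expand_J {S : Finset (Fin n)} (hS : ∀ u ∈ S, π u ∈ S) (H : Finset (Fin n)) {t' : ℕ}
    (ht' : 2 ≤ t') (g : ℕ) (C : Finset ℕ) (w : ℕ → ℝ) (p : ℝ[X]) (hpC : ∀ c ∈ C, c < g → p.eval (c : ℝ) = 0)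
    (hne : ∀ c ∈ C, g + 1 ≤ c → (shellIn π S t' (c - g)).Nonempty) (f : Finset (Fin n) → ℝ) (α : Fin n → ℝ)
    (kap L : ℝ) :
    ∑ c ∈ C, w c * (p.eval (c : ℝ) *
        ((∑ U ∈ shellIn π S t' (c - g), f (U ∩ H) *
            ((∑ v ∈ U ∩ H, α v) - (∑ v ∈ S ∩ H, α v * (if (v ∈ U ∧ π v ∉ U) then (1 : ℝ) else 0)) + L - kap * c) ^ 2) /
          ((shellIn π S t' (c - g)).card : ℝ))) =
      ∑ c ∈ C, w c * (p.eval (c : ℝ) *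
          ((∑ U ∈ shellIn π S t' (c - g), (fun I => f I * ((∑ v ∈ I, α v) + L) ^ 2) (U ∩ H)) /
            ((shellIn π S t' (c - g)).card : ℝ)))
      - 2 * kap * ∑ c ∈ C, w c * ((p * X).eval (c : ℝ) *
          ((∑ U ∈ shellIn π S t' (c - g), (fun I => f I * ((∑ v ∈ I, α v) + L)) (U ∩ H)) /
            ((shellIn π S t' (c - g)).card : ℝ)))
      + kap ^ 2 * ∑ c ∈ C, w c * ((p * X ^ 2).eval (c : ℝ) *
          ((∑ U ∈ shellIn π S t' (c - g), f (U ∩ H)) / ((shellIn π S t' (c - g)).card : ℝ)))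
      - 2 / (S.card : ℝ) * ∑ v ∈ S ∩ H, ∑ c ∈ C, w c * ((p * (X - Polynomial.C (g : ℝ))).eval (c : ℝ) *
          (α v * ((∑ W ∈ shellIn π (S \ {v, π v}) (t' - 1) (c - g - 1),
              (fun J => f (insert v J) * ((∑ u ∈ insert v J, α u) + L)) (W ∩ H)) /
            ((shellIn π (S \ {v, π v}) (t' - 1) (c - g - 1)).card : ℝ))))
      + 2 * kap / (S.card : ℝ) * ∑ v ∈ S ∩ H, ∑ c ∈ C,
          w c * ((p * X * (X - Polynomial.C (g : ℝ))).eval (c : ℝ) *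
          (α v * ((∑ W ∈ shellIn π (S \ {v, π v}) (t' - 1) (c - g - 1), (fun J => f (insert v J)) (W ∩ H)) /
            ((shellIn π (S \ {v, π v}) (t' - 1) (c - g - 1)).card : ℝ))))
      + 1 / (S.card : ℝ) * ∑ v ∈ S ∩ H, ∑ c ∈ C,
          w c * ((p * (X - Polynomial.C (g : ℝ))).eval (c : ℝ) *
          (α v ^ 2 * ((∑ W ∈ shellIn π (S \ {v, π v}) (t' - 1) (c - g - 1), (fun J => f (insert v J)) (W ∩ H)) /
            ((shellIn π (S \ {v, π v}) (t' - 1) (c - g - 1)).card : ℝ))))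
      + 1 / ((S.card : ℝ) * ((S.card : ℝ) - 2)) * ∑ v ∈ S ∩ H, ∑ w' ∈ (S ∩ H) \ {v, π v}, ∑ c ∈ C,
          w c * ((p * (X - Polynomial.C (g : ℝ)) * (X - Polynomial.C ((g : ℝ) + 1))).eval (c : ℝ) *
          (α v * α w' * ((∑ W ∈ shellIn π (del2 π S v w') (t' - 2) (c - g - 2),
              (fun J => f (insert v (insert w' J))) (W ∩ H)) /
            ((shellIn π (del2 π S v w') (t' - 2) (c - g - 2)).card : ℝ)))) := by
  -- per level
  have hlev : ∀ c ∈ C, w c * (p.eval (c : ℝ) *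
        ((∑ U ∈ shellIn π S t' (c - g), f (U ∩ H) *
            ((∑ v ∈ U ∩ H, α v) - (∑ v ∈ S ∩ H, α v * (if (v ∈ U ∧ π v ∉ U) then (1 : ℝ) else 0)) + L - kap * c) ^ 2) /
          ((shellIn π S t' (c - g)).card : ℝ))) =
      w c * (p.eval (c : ℝ) *
          ((∑ U ∈ shellIn π S t' (c - g), (fun I => f I * ((∑ v ∈ I, α v) + L) ^ 2) (U ∩ H)) /
            ((shellIn π S t' (c - g)).card : ℝ)))
      - 2 * kap * (w c * ((p * X).eval (c : ℝ) *
          ((∑ U ∈ shellIn π S t' (c - g), (fun I => f I * ((∑ v ∈ I, α v) + L)) (U ∩ H)) /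
            ((shellIn π S t' (c - g)).card : ℝ))))
      + kap ^ 2 * (w c * ((p * X ^ 2).eval (c : ℝ) *
          ((∑ U ∈ shellIn π S t' (c - g), f (U ∩ H)) / ((shellIn π S t' (c - g)).card : ℝ))))
      - 2 / (S.card : ℝ) * ∑ v ∈ S ∩ H, w c * ((p * (X - Polynomial.C (g : ℝ))).eval (c : ℝ) *
          (α v * ((∑ W ∈ shellIn π (S \ {v, π v}) (t' - 1) (c - g - 1),
              (fun J => f (insert v J) * ((∑ u ∈ insert v J, α u) + L)) (W ∩ H)) /
            ((shellIn π (S \ {v, π v}) (t' - 1) (c - g - 1)).card : ℝ))))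
      + 2 * kap / (S.card : ℝ) * ∑ v ∈ S ∩ H,
          w c * ((p * X * (X - Polynomial.C (g : ℝ))).eval (c : ℝ) *
          (α v * ((∑ W ∈ shellIn π (S \ {v, π v}) (t' - 1) (c - g - 1), (fun J => f (insert v J)) (W ∩ H)) /
            ((shellIn π (S \ {v, π v}) (t' - 1) (c - g - 1)).card : ℝ))))
      + 1 / (S.card : ℝ) * ∑ v ∈ S ∩ H,
          w c * ((p * (X - Polynomial.C (g : ℝ))).eval (c : ℝ) *
          (α v ^ 2 * ((∑ W ∈ shellIn π (S \ {v, π v}) (t' - 1) (c - g - 1), (fun J => f (insert v J)) (W ∩ H)) /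
            ((shellIn π (S \ {v, π v}) (t' - 1) (c - g - 1)).card : ℝ))))
      + 1 / ((S.card : ℝ) * ((S.card : ℝ) - 2)) * ∑ v ∈ S ∩ H, ∑ w' ∈ (S ∩ H) \ {v, π v},
          w c * ((p * (X - Polynomial.C (g : ℝ)) * (X - Polynomial.C ((g : ℝ) + 1))).eval (c : ℝ) *
          (α v * α w' * ((∑ W ∈ shellIn π (del2 π S v w') (t' - 2) (c - g - 2),
              (fun J => f (insert v (insert w' J))) (W ∩ H)) /
            ((shellIn π (del2 π S v w') (t' - 2) (c - g - 2)).card : ℝ)))) := by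
    intro c hc
    have hne' : 1 ≤ c - g → (shellIn π S t' (c - g)).Nonempty := fun h => hne c hc (by omega)
    rw [avg_tilted_expand_J hπ hπ' hS H ht' (c - g) hne' f α kap L (c : ℝ)]
    simp only [eval_mul, eval_X, eval_pow, eval_sub, eval_C, ← mul_sum]
    rcases le_or_gt g c with hgc | hgc
    · rw [Nat.cast_sub hgc]
      ring
    · rw [hpC c hc hgc]
      ring
  rw [sum_congr rfl hlev]
  exact sum_regroup7 C (S ∩ H) (fun v => (S ∩ H) \ {v, π v}) _ _ _ _ _ _ _ _ _ _ _ _ _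

end LevelSum

/-! ### §5 Small tools for the assembly -/

section Tools

/-- **The amplitude of a junta tilt**: for `|α_v| ≤ 4`, `|L| ≤ L₀` and `I` with `|I| ≤ b`: `|Σ_{v∈I} α_v + L| ≤ 4b + L₀`.
[cite: Rothvoss2017, §2 (PDF p. 6)] -/
theorem junta_amplitude_abs_le (α : Fin n → ℝ) (hα : ∀ v, |α v| ≤ 4) {L L₀ : ℝ} (hL : |L| ≤ L₀) {b : ℕ} {I : Finset (Fin n)}
    (hI : I.card ≤ b) : |(∑ v ∈ I, α v) + L| ≤ 4 * (b : ℝ) + L₀ := by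
  have h1 : |∑ v ∈ I, α v| ≤ 4 * (b : ℝ) :=
    calc |∑ v ∈ I, α v| ≤ ∑ v ∈ I, |α v| := abs_sum_le_sum_abs _ _
      _ ≤ ∑ _v ∈ I, (4 : ℝ) := sum_le_sum fun v _ => hα v
      _ = 4 * (I.card : ℝ) := by rw [sum_const, nsmul_eq_mul, mul_comm]
      _ ≤ 4 * (b : ℝ) := by have : (I.card : ℝ) ≤ b := by exact_mod_cast hI
                            linarith
  exact (abs_add_le _ _).trans (add_le_add h1 hL)

/-- **Junta mask bounds.** For `|f| ≤ G`, `f ≥ 0`, `|α| ≤ 4`, `|L| ≤ L₀` and a block with `|S ∩ H| ≤ b`: on the subsets of `S ∩ H` the main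
piece `f(A+L)²` is bounded by `G(4b+L₀)²` and nonnegative, `f(A+L)` by `G(4b+L₀)`; the same for the one-vertex-shifted masks on the pinned
ground sets `S ∖ e_v`, `v ∈ S ∩ H`. [cite: Rothvoss2017, §2 (PDF p. 6)] -/
theorem junta_mask_bounds {π : Fin n → Fin n} (f : Finset (Fin n) → ℝ) {G : ℝ} (hG : ∀ I, |f I| ≤ G) (hf0 : ∀ I, 0 ≤ f I)
    (α : Fin n → ℝ) (hα : ∀ v, |α v| ≤ 4) {L L₀ : ℝ} (hL : |L| ≤ L₀) {S H : Finset (Fin n)} {b : ℕ} (hb : (S ∩ H).card ≤ b) :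
    (∀ I ⊆ S ∩ H, |(fun I => f I * ((∑ v ∈ I, α v) + L) ^ 2) I| ≤ G * (4 * (b : ℝ) + L₀) ^ 2) ∧
    (∀ I ⊆ S ∩ H, 0 ≤ (fun I => f I * ((∑ v ∈ I, α v) + L) ^ 2) I) ∧
    (∀ I ⊆ S ∩ H, |(fun I => f I * ((∑ v ∈ I, α v) + L)) I| ≤ G * (4 * (b : ℝ) + L₀)) ∧
    (∀ v ∈ S ∩ H, ∀ J ⊆ (S \ {v, π v}) ∩ H,
      |(fun J => f (insert v J) * ((∑ u ∈ insert v J, α u) + L)) J| ≤ G * (4 * (b : ℝ) + L₀)) := by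
  have hG0 : 0 ≤ G := (abs_nonneg _).trans (hG ∅)
  have hamp : ∀ I ⊆ S ∩ H, |(∑ v ∈ I, α v) + L| ≤ 4 * (b : ℝ) + L₀ := fun I hI =>
    junta_amplitude_abs_le α hα hL ((card_le_card hI).trans hb)
  refine ⟨fun I hI => ?_, fun I _ => mul_nonneg (hf0 I) (sq_nonneg _), fun I hI => ?_, fun v hv J hJ => ?_⟩
  · simp only [abs_mul, abs_pow]
    exact mul_le_mul (hG I) (pow_le_pow_left₀ (abs_nonneg _) (hamp I hI) 2) (by positivity) hG0
  · simp only [abs_mul]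
    exact mul_le_mul (hG I) (hamp I hI) (abs_nonneg _) hG0
  · have hI : insert v J ⊆ S ∩ H := insert_subset hv (hJ.trans (inter_subset_inter_right sdiff_subset))
    simp only [abs_mul]
    exact mul_le_mul (hG _) (hamp _ hI) (abs_nonneg _) hG0

/-- **Assembly arithmetic (seven pieces).** With `M = B_v·P·K_c·G·Q ≥ 0`, `Λ, T ≥ 0`: main piece `≤ MΛ²`, the plain pieces `2(PT)(GΛ)`- and
`1(PT²)G`-bounded, the pinned pieces `8(PT)(GΛ)`, `8(PT²)G`, `16(PT)G`, `16(PT²)G`, sum to at most `M(Λ + 5T + 4)²` (brick 151's polynomial).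
[cite: Rothvoss2017, §2 (PDF p. 6)] -/
theorem seven_piece_bound {Bv P Kc G Q T Λ A X₁ X₂ X₃ X₄ X₅ X₆ : ℝ}
    (hBv : 0 ≤ Bv) (hP : 0 ≤ P) (hKc : 0 ≤ Kc) (hG : 0 ≤ G) (hQ : 0 ≤ Q) (hT : 0 ≤ T) (hΛ : 0 ≤ Λ)
    (hA : A ≤ Bv * P * Kc * (G * Λ ^ 2 * Q))
    (h₁ : |X₁| ≤ 2 * (Bv * (P * T) * Kc * (G * Λ * Q))) (h₂ : |X₂| ≤ 1 * (Bv * (P * T ^ 2) * Kc * (G * Q)))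
    (h₃ : |X₃| ≤ 2 * (4 * (Bv * (P * T) * Kc * (G * Λ * Q)))) (h₄ : |X₄| ≤ 2 * (4 * (Bv * (P * T ^ 2) * Kc * (G * Q))))
    (h₅ : |X₅| ≤ 1 * (16 * (Bv * (P * T) * Kc * (G * Q)))) (h₆ : |X₆| ≤ 1 * (16 * (Bv * (P * T ^ 2) * Kc * (G * Q)))) :
    A - X₁ + X₂ - X₃ + X₄ + X₅ + X₆ ≤ Bv * P * Kc * (G * (Λ + 5 * T + 4) ^ 2 * Q) := by
  have hpoly : Λ ^ 2 + 10 * T * Λ + 25 * T ^ 2 + 16 * T ≤ (Λ + 5 * T + 4) ^ 2 := by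
    have e : (Λ + 5 * T + 4) ^ 2 = Λ ^ 2 + 10 * T * Λ + 25 * T ^ 2 + 16 * T + (16 + 8 * Λ + 24 * T) := by ring
    rw [e]; linarith only [hΛ, hT]
  have hMM : 0 ≤ Bv * P * Kc * G * Q := by positivity
  have hsum : Bv * P * Kc * (G * Λ ^ 2 * Q) + 2 * (Bv * (P * T) * Kc * (G * Λ * Q)) + 1 * (Bv * (P * T ^ 2) * Kc * (G * Q))
      + 2 * (4 * (Bv * (P * T) * Kc * (G * Λ * Q))) + 2 * (4 * (Bv * (P * T ^ 2) * Kc * (G * Q)))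
      + 1 * (16 * (Bv * (P * T) * Kc * (G * Q))) + 1 * (16 * (Bv * (P * T ^ 2) * Kc * (G * Q))) ≤
      Bv * P * Kc * (G * (Λ + 5 * T + 4) ^ 2 * Q) := by
    have e1 : Bv * P * Kc * (G * Λ ^ 2 * Q) + 2 * (Bv * (P * T) * Kc * (G * Λ * Q)) + 1 * (Bv * (P * T ^ 2) * Kc * (G * Q))
      + 2 * (4 * (Bv * (P * T) * Kc * (G * Λ * Q))) + 2 * (4 * (Bv * (P * T ^ 2) * Kc * (G * Q)))
      + 1 * (16 * (Bv * (P * T) * Kc * (G * Q))) + 1 * (16 * (Bv * (P * T ^ 2) * Kc * (G * Q))) =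
        Bv * P * Kc * G * Q * (Λ ^ 2 + 10 * T * Λ + 25 * T ^ 2 + 16 * T) := by ring
    have e2 : Bv * P * Kc * (G * (Λ + 5 * T + 4) ^ 2 * Q) = Bv * P * Kc * G * Q * (Λ + 5 * T + 4) ^ 2 := by ring
    rw [e1, e2]
    exact mul_le_mul_of_nonneg_left hpoly hMM
  linarith only [hA, (abs_le.1 h₁).1, (abs_le.1 h₂).2, (abs_le.1 h₃).1, (abs_le.1 h₄).2, (abs_le.1 h₅).2, (abs_le.1 h₆).2, hsum]

end Tools

end Summit.PneNP.PneNP.Theorems.ChebyshevTracialDesignTiltedJuntaExpansion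

end
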